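import Summits.FinalStateConjecture.FinalStateConjecture.Theses.PhaseMixingCapture
import Literature.Geometry.Lorentzian.CarterAngularBarrierDecay
import Literature.Geometry.Lorentzian.CarterConeArithmetic
import Summits.FinalStateConjecture.FinalStateConjecture.Theorems.PhaseMixingCaptureKappaExplicitWaveDecayConeKernelLargeStableLayerPoly
import Summits.FinalStateConjecture.FinalStateConjecture.Theorems.PhaseMixingCaptureKappaExplicitWaveDecayConeKernelLargeStableSuperradiantPoly
import Summits.FinalStateConjecture.FinalStateConjecture.Theorems.PhaseMixingCaptureKappaExplicitWaveDecayFluxRegimeCorePoly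
import Summits.FinalStateConjecture.FinalStateConjecture.Theorems.PhaseMixingCaptureKappaExplicitWaveDecayPolyPlumbing
import Summits.FinalStateConjecture.FinalStateConjecture.Theorems.PhaseMixingCaptureKappaExplicitWaveDecayFullConeCensus
import HarnessLib

/-!
# Decay of the cone Green kernel across the angular barrier, Λ-polynomial constants
# (stub `stub_coneBarrierDecayPoly` of the line `olver-dunster-uniform-reduction`)

Crux `PhaseMixingCapture.KappaExplicitWaveDecay` (stmt-FinalStateConjecture-10654), stub S6e (skeleton
v9.5): for `M > 0`, `θ > 0`, `R_b ≥ 7M` there are `a₁ < M`, `ε₀, C_c, C, c > 0`, `N` such that for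
`a₁ ≤ |a| < M`, `R_f ≥ 2R_b`, admissible `(ω, m, Λ)`, `m ≠ 0`, in the cone `|ω − mω₊| ≤ ε₀|m|`,
ANGULAR-dominated `C_c(1 + ω²R_f²) ≤ Λ`, the normalised radial Teukolsky pair and
`r₊ + θ(r₊ − r₋) ≤ r ≤ R_b`, `r′ ≥ R_f`:
`√(r²+a²)‖R_𝓗 r‖·√(r′²+a²)‖R_𝓘 r′‖ ≤ CΛ^Nκ^{-N}·(R_b/min(r′, R_Λ))^{c√Λ}·‖𝔚(r)‖`, `R_Λ = √(Λ/(C_c(1 + ω²)))`.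

Proof. (1) Here `Λ ≥ C_c ≥ Λ₀ + 1` and (`|a| ≥ M/2`, `ε₀ ≤ 1/(16M)` ⇒ `|m| ≤ 16M|ω|`)
`2(2r₊ω)² + 2amω ≤ 64M²ω² ≤ Λ`: the frequency is Breitenlohner–Freedman STABLE with margin `θ₁ = 1` at
large `Λ`, where the cone kernel bound `≤ C′Λ^{N′}κ^{-N′}‖𝔚‖` is LANDED in every sector (threshold layer
`stub_coneKernelLargeStableLayerPoly`, superradiant `stub_coneKernelLargeStableSuperradiantPoly`, flux regime
`stub_fluxRegimeCorePoly` + `stub_polyPlumbing` + `stub_fullConeCensus`; merged as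
`coneKernel_largeStable_all`); it is applied to the pair `(r, R_b)`. (2) The ratio
`√(r′²+a²)‖R_𝓘 r′‖ / √(R_b²+a²)‖R_𝓘 R_b‖` is the inward growth of the `𝓘⁺`-mode through the angular barrier
(`V − ω² ≥ Λ/(4r²)` on `7M ≤ r ≤ 2R_Λ` as `256ω²R_Λ² ≤ Λ`): `Kerr.angularBarrier_decay_radial`
(`Literature/Geometry/Lorentzian/CarterAngularBarrierDecay.lean`) bounds it by
`(6 + 6|ω|R_far)·(R_b/min(r′, R_Λ))^{√Λ/8}`, and `6 + 6|ω|R_far ≤ 165Λ` in the cone. (3) If `R_Λ < R_b` the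
decay factor is `≥ 1` and the plain kernel bound at `(r, r′)` suffices. Constants: `a₁ ⊔ M/2`,
`ε₀ ⊓ 1/(16M)`, `C_c = (Λ₀ + 1) ⊔ 256`, `C = 42C′/M`, `c = 1/8`, `N = N′ + 1`.
-/

set_option linter.dupNamespace false

noncomputable section

namespace Summit.FinalStateConjecture.FinalStateConjecture.Theorems.KappaExplicitWaveDecay.OlverDunsterUniformReduction

open Summit.FinalStateConjecture.FinalStateConjecture.Theses.PhaseMixingCapture Literature.Geometry.Lorentzian
open Literature.Analysis.ODE MeasureTheory Filter Set Complex
open scoped Topology Manifold ENNReal ComplexConjugate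

set_option maxHeartbeats 400000 in
-- three regimes merged; many binders
/-- **The large-Λ BF-stable cone kernel bound in EVERY sector of the cone** (threshold layer
`|σ| ≤ 2ξ₁κ` by T2sA, superradiant `ωσ ≤ 0` off the layer by T2sB, non-superradiant `ωσ ≥ 0` off the
layer by the flux regime at `δ = 2ξ₁`; all landed): for `M > 0`, `θ > 0`, `θ₁ > 0` there are `Λ₀`,
`a₁ < M`, `ε₀ > 0`, `C > 0`, `N` such that the kernel bound `≤ CΛ^Nκ^{-N}‖𝔚(r)‖` holds for admissible
`(ω, m, Λ)`, `m ≠ 0`, `Λ₀ < Λ`, `(1 + θ₁)(2r₊ω)² ≤ Λ − 2amω`, `|ω − mω₊| ≤ ε₀|m|`. -/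
theorem coneKernel_largeStable_all (M : ℝ) (hM : 0 < M) (θ : ℝ) (hθ : 0 < θ) (θ₁ : ℝ) (hθ₁ : 0 < θ₁) :
    ∃ (Λ₀ a₁ ε₀ C : ℝ) (N : ℕ), a₁ < M ∧ 0 < ε₀ ∧ 0 < C ∧
      ∀ a : ℝ, a₁ ≤ |a| → Kerr.IsSubextremal M a →
        ∀ (ω : ℝ) (m : ℤ) (Λ : ℝ), Kerr.IsAdmissibleTriple a ω m Λ → m ≠ 0 → Λ₀ < Λ →
          (1 + θ₁) * (2 * Kerr.rPlus M a * ω) ^ 2 ≤ Λ - 2 * a * m * ω →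
          |ω - m * Kerr.horizonAngularVelocity M a| ≤ ε₀ * |(m : ℝ)| →
            ∀ RH RI : ℝ → ℂ,
              Kerr.IsRadialTeukolskySolution M a 0 ω m (Λ - a ^ 2 * ω ^ 2) RH →
              Kerr.IsNormalisedHorizonSolution M a 0 ω m RH →
              Kerr.IsRadialTeukolskySolution M a 0 ω m (Λ - a ^ 2 * ω ^ 2) RI →
              Kerr.IsNormalisedInfinitySolution M 0 ω RI →
                ∀ r r' : ℝ, Kerr.rPlus M a < r → r ≤ r' →
                  Kerr.rPlus M a + θ * (Kerr.rPlus M a - Kerr.rMinus M a) ≤ r' →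
                    Real.sqrt (r ^ 2 + a ^ 2) * ‖RH r‖ * (Real.sqrt (r' ^ 2 + a ^ 2) * ‖RI r'‖) ≤
                      C * Λ ^ N * (Kerr.surfaceGravity M a)⁻¹ ^ N * ‖Kerr.radialWronskian M a 0 RH RI r‖ := by
  obtain ⟨ξ₁, Λ₀, a₁, ε₀, C, N, hξ₁, ha₁, hε₀, hC, hA'⟩ :=
    stub_coneKernelLargeStableLayerPoly M hM θ hθ θ₁ hθ₁
  obtain ⟨Λ₀', a₁', ε₀', C', N', ha₁', hε₀', hC', hB'⟩ :=
    stub_coneKernelLargeStableSuperradiantPoly M hM θ hθ ξ₁ hξ₁ θ₁ hθ₁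
  -- the flux regime at `δ = 2ξ₁` in the `R`-language
  have hP : ∀ M a ω (m : ℤ),
      (2 * ξ₁ * Kerr.surfaceGravity M a ≤ |ω - m * Kerr.horizonAngularVelocity M a| ∧
        0 ≤ ω * (ω - m * Kerr.horizonAngularVelocity M a)) →
      (2 * ξ₁ * Kerr.surfaceGravity M a ≤ |(-ω) - ((-m : ℤ) : ℝ) * Kerr.horizonAngularVelocity M a| ∧
        0 ≤ (-ω) * ((-ω) - ((-m : ℤ) : ℝ) * Kerr.horizonAngularVelocity M a)) := by
    intro M a ω m ⟨h1, h2⟩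
    push_cast
    refine ⟨?_, by nlinarith [h2]⟩
    rw [show -ω - -(m : ℝ) * Kerr.horizonAngularVelocity M a = -(ω - m * Kerr.horizonAngularVelocity M a) by ring,
      abs_neg]; exact h1
  obtain ⟨a₁'', ε₀'', C'', N'', ha₁'', hε₀'', hC'', hF'⟩ :=
    stub_polyPlumbing.1 (fun M a ω m ↦ 2 * ξ₁ * Kerr.surfaceGravity M a ≤ |ω - m * Kerr.horizonAngularVelocity M a| ∧
        0 ≤ ω * (ω - m * Kerr.horizonAngularVelocity M a)) hP
      (stub_fluxRegimeCorePoly stub_fullConeCensus (2 * ξ₁) (by positivity)) M hM θ hθ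
  have hL4 : (0 : ℝ) < 4 * M := by positivity
  set D : ℝ := C / (4 * M) ^ (N' + N'') + C' / (4 * M) ^ (N + N'') + C'' / (4 * M) ^ (N + N') with hD
  have hD1 : 0 ≤ C / (4 * M) ^ (N' + N'') := by positivity
  have hD2 : 0 ≤ C' / (4 * M) ^ (N + N'') := by positivity
  have hD3 : 0 ≤ C'' / (4 * M) ^ (N + N') := by positivity
  have hD0 : 0 < D := by positivity
  refine ⟨max Λ₀ Λ₀', max a₁ (max a₁' a₁''), min ε₀ (min ε₀' ε₀''), D, N + N' + N'',
    max_lt ha₁ (max_lt ha₁' ha₁''), lt_min hε₀ (lt_min hε₀' hε₀''), hD0, ?_⟩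
  intro a ha hsub ω m Λ hadm hm hΛ hst hcone RH RI hH hnH hI hnI r r' hr hrr' hr'
  have hΛ1 : (1 : ℝ) ≤ Λ := by
    have hm1 : (1 : ℝ) ≤ |(m : ℝ)| := by
      rw [← Int.cast_abs, ← Int.cast_one, Int.cast_le]; exact Int.one_le_abs hm
    have h2 := hadm.sq_le
    nlinarith [sq_abs (m : ℝ)]
  have hκ : 0 < Kerr.surfaceGravity M a := (Kerr.surfaceGravity_pos_iff hM a).2 hsub
  have hκle : Kerr.surfaceGravity M a ≤ 1 / (4 * M) := Kerr.surfaceGravity_le hM a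
  have hW0 : 0 ≤ ‖Kerr.radialWronskian M a 0 RH RI r‖ := norm_nonneg _
  have ha1 : a₁ ≤ |a| := le_trans (le_max_left _ _) ha
  have ha2 : a₁' ≤ |a| := le_trans ((le_max_left _ _).trans (le_max_right _ _)) ha
  have ha3 : a₁'' ≤ |a| := le_trans ((le_max_right _ _).trans (le_max_right _ _)) ha
  have hc1 : |ω - m * Kerr.horizonAngularVelocity M a| ≤ ε₀ * |(m : ℝ)| :=
    hcone.trans (mul_le_mul_of_nonneg_right (min_le_left _ _) (abs_nonneg _))
  have hc2 : |ω - m * Kerr.horizonAngularVelocity M a| ≤ ε₀' * |(m : ℝ)| :=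
    hcone.trans (mul_le_mul_of_nonneg_right ((min_le_right _ _).trans (min_le_left _ _)) (abs_nonneg _))
  have hc3 : |ω - m * Kerr.horizonAngularVelocity M a| ≤ ε₀'' * |(m : ℝ)| :=
    hcone.trans (mul_le_mul_of_nonneg_right ((min_le_right _ _).trans (min_le_right _ _)) (abs_nonneg _))
  have hpoly : 0 ≤ Λ ^ (N + N' + N'') * (Kerr.surfaceGravity M a)⁻¹ ^ (N + N' + N'') *
      ‖Kerr.radialWronskian M a 0 RH RI r‖ := by positivity
  rcases le_or_gt |ω - m * Kerr.horizonAngularVelocity M a| (2 * ξ₁ * Kerr.surfaceGravity M a) with hlay | hoff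
  · have h := hA' a ha1 hsub ω m Λ hadm hm (lt_of_le_of_lt (le_max_left _ _) hΛ) hst hc1 hlay RH RI hH hnH hI hnI
      r r' hr hrr' hr'
    have h2 := polyConst_raise N (N' + N'') hM hκ hκle hΛ1 hC.le hW0
    rw [show N + (N' + N'') = N + N' + N'' by omega] at h2
    refine h.trans (h2.trans ?_)
    have : C / (4 * M) ^ (N' + N'') ≤ D := by rw [hD]; linarith
    calc _ = C / (4 * M) ^ (N' + N'') * (Λ ^ (N + N' + N'') * (Kerr.surfaceGravity M a)⁻¹ ^ (N + N' + N'') *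
          ‖Kerr.radialWronskian M a 0 RH RI r‖) := by ring
      _ ≤ D * (Λ ^ (N + N' + N'') * (Kerr.surfaceGravity M a)⁻¹ ^ (N + N' + N'') *
          ‖Kerr.radialWronskian M a 0 RH RI r‖) := mul_le_mul_of_nonneg_right this hpoly
      _ = _ := by ring
  · by_cases hsr : ω * (ω - m * Kerr.horizonAngularVelocity M a) ≤ 0
    · have h := hB' a ha2 hsub ω m Λ hadm hm (lt_of_le_of_lt (le_max_right _ _) hΛ) hst hc2 hsr hoff.le RH RI
        hH hnH hI hnI r r' hr hrr' hr'
      have h2 := polyConst_raise N' (N + N'') hM hκ hκle hΛ1 hC'.le hW0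
      rw [show N' + (N + N'') = N + N' + N'' by omega] at h2
      refine h.trans (h2.trans ?_)
      have : C' / (4 * M) ^ (N + N'') ≤ D := by rw [hD]; linarith
      calc _ = C' / (4 * M) ^ (N + N'') * (Λ ^ (N + N' + N'') * (Kerr.surfaceGravity M a)⁻¹ ^ (N + N' + N'') *
            ‖Kerr.radialWronskian M a 0 RH RI r‖) := by ring
        _ ≤ D * (Λ ^ (N + N' + N'') * (Kerr.surfaceGravity M a)⁻¹ ^ (N + N' + N'') *
            ‖Kerr.radialWronskian M a 0 RH RI r‖) := mul_le_mul_of_nonneg_right this hpoly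
        _ = _ := by ring
    · have hpos : 0 ≤ ω * (ω - m * Kerr.horizonAngularVelocity M a) := (not_le.1 hsr).le
      have h := hF' a ha3 hsub ω m Λ hadm hm hc3 ⟨hoff.le, hpos⟩ RH RI hH hnH hI hnI r r' hr hrr' hr'
      have h2 := polyConst_raise N'' (N + N') hM hκ hκle hΛ1 hC''.le hW0
      rw [show N'' + (N + N') = N + N' + N'' by omega] at h2
      refine h.trans (h2.trans ?_)
      have : C'' / (4 * M) ^ (N + N') ≤ D := by rw [hD]; linarith
      calc _ = C'' / (4 * M) ^ (N + N') * (Λ ^ (N + N' + N'') * (Kerr.surfaceGravity M a)⁻¹ ^ (N + N' + N'') *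
            ‖Kerr.radialWronskian M a 0 RH RI r‖) := by ring
        _ ≤ D * (Λ ^ (N + N' + N'') * (Kerr.surfaceGravity M a)⁻¹ ^ (N + N' + N'') *
            ‖Kerr.radialWronskian M a 0 RH RI r‖) := mul_le_mul_of_nonneg_right this hpoly
        _ = _ := by ring

/-- **Size of `ω` in the cone** (`M/2 ≤ |a| ≤ M`, `m ≠ 0`, `ε₀ ≤ 1/(16M)`, `|ω − mω₊| ≤ ε₀|m|`):
`1/(16M) ≤ |ω|`, `|m| ≤ 16M|ω|` and `M|ω| ≤ |m|`. [folklore] -/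
theorem cone_omega_facts {M a ω ε₀ : ℝ} {m : ℤ} (hM : 0 < M) (haM : |a| ≤ M) (ha : M / 2 ≤ |a|)
    (hm : m ≠ 0) (hε₀ : ε₀ ≤ 1 / (16 * M))
    (hcone : |ω - m * Kerr.horizonAngularVelocity M a| ≤ ε₀ * |(m : ℝ)|) :
    1 / (16 * M) ≤ |ω| ∧ |(m : ℝ)| ≤ 16 * M * |ω| ∧ M * |ω| ≤ |(m : ℝ)| := by
  set μ := |(m : ℝ)| with hμ
  have hμ1 : 1 ≤ μ := by
    rw [hμ, ← Int.cast_abs, ← Int.cast_one, Int.cast_le]; exact Int.one_le_abs hm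
  have hup := Kerr.abs_horizonAngularVelocity_le hM haM
  have hlow := Kerr.le_abs_horizonAngularVelocity hM ha
  have hσ : |ω - m * Kerr.horizonAngularVelocity M a| ≤ μ / (16 * M) := by
    calc _ ≤ ε₀ * μ := hcone
      _ ≤ 1 / (16 * M) * μ := mul_le_mul_of_nonneg_right hε₀ (by linarith)
      _ = μ / (16 * M) := by ring
  have hmω : |(m : ℝ) * Kerr.horizonAngularVelocity M a| = μ * |Kerr.horizonAngularVelocity M a| := by
    rw [abs_mul]
  have h1 : μ * |Kerr.horizonAngularVelocity M a| - μ / (16 * M) ≤ |ω| := by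
    have := abs_sub_abs_le_abs_sub ((m : ℝ) * Kerr.horizonAngularVelocity M a) ω
    rw [abs_sub_comm] at this
    linarith
  have h2 : |ω| ≤ μ * |Kerr.horizonAngularVelocity M a| + μ / (16 * M) := by
    have := abs_add_le ((m : ℝ) * Kerr.horizonAngularVelocity M a) (ω - m * Kerr.horizonAngularVelocity M a)
    rw [add_sub_cancel] at this
    linarith
  have h3 : μ * (1 / (8 * M)) ≤ μ * |Kerr.horizonAngularVelocity M a| :=
    mul_le_mul_of_nonneg_left hlow (by linarith)
  have h4 : μ * |Kerr.horizonAngularVelocity M a| ≤ μ * (1 / (2 * M)) :=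
    mul_le_mul_of_nonneg_left hup (by linarith)
  have e1 : μ * (1 / (8 * M)) - μ / (16 * M) = μ / (16 * M) := by field_simp; ring
  have e2 : μ * (1 / (2 * M)) + μ / (16 * M) = 9 / 16 * (μ / M) := by field_simp; ring
  have hωlow : μ / (16 * M) ≤ |ω| := by linarith
  refine ⟨?_, ?_, ?_⟩
  · calc 1 / (16 * M) ≤ μ / (16 * M) := by
          rw [div_le_div_iff_of_pos_right (by positivity)]; exact hμ1
      _ ≤ |ω| := hωlow
  · rw [div_le_iff₀ (by positivity)] at hωlow; linarith
  · have h5 : |ω| ≤ 9 / 16 * (μ / M) := by linarith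
    rw [← le_div_iff₀' hM]
    have : 0 ≤ μ / M := by positivity
    linarith

/-- **The decay constant is Λ-linear in the cone**: `1/(16M) ≤ |ω|`, `M|ω| ≤ √Λ`, `1 ≤ Λ` give
`6 + 6|ω|·max(7M, √(12Λ)/|ω|, 1/(Mω²)) ≤ 165Λ`. [folklore] -/
theorem decayConst_le {M ω Λ : ℝ} (hM : 0 < M) (hωlow : 1 / (16 * M) ≤ |ω|) (hωup : M * |ω| ≤ Real.sqrt Λ)
    (hΛ1 : 1 ≤ Λ) :
    6 + 6 * |ω| * max (7 * M) (max (Real.sqrt (12 * Λ) / |ω|) (1 / (M * ω ^ 2))) ≤ 165 * Λ := by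
  have hω : 0 < |ω| := lt_of_lt_of_le (by positivity) hωlow
  have hsΛ1 : 1 ≤ Real.sqrt Λ := by rw [← Real.sqrt_one]; exact Real.sqrt_le_sqrt hΛ1
  have hsΛ : Real.sqrt Λ ≤ Λ := by
    calc Real.sqrt Λ = Real.sqrt Λ * 1 := (mul_one _).symm
      _ ≤ Real.sqrt Λ * Real.sqrt Λ := mul_le_mul_of_nonneg_left hsΛ1 (Real.sqrt_nonneg _)
      _ = Λ := Real.mul_self_sqrt (by linarith)
  have h12 : Real.sqrt (12 * Λ) ≤ 7 / 2 * Real.sqrt Λ := by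
    rw [Real.sqrt_mul (by norm_num)]
    refine mul_le_mul_of_nonneg_right ?_ (Real.sqrt_nonneg _)
    rw [Real.sqrt_le_left (by norm_num)]; norm_num
  -- `|ω| · max ≤ 7M|ω| + √(12Λ) + 1/(M|ω|)`
  have hA : 0 ≤ 7 * M := by positivity
  have hB : 0 ≤ Real.sqrt (12 * Λ) / |ω| := by positivity
  have hC : 0 ≤ 1 / (M * ω ^ 2) := by positivity
  have hmax : max (7 * M) (max (Real.sqrt (12 * Λ) / |ω|) (1 / (M * ω ^ 2))) ≤
      7 * M + Real.sqrt (12 * Λ) / |ω| + 1 / (M * ω ^ 2) :=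
    max_le (by linarith) (max_le (by linarith) (by linarith))
  have e : |ω| * (7 * M + Real.sqrt (12 * Λ) / |ω| + 1 / (M * ω ^ 2)) =
      7 * (M * |ω|) + Real.sqrt (12 * Λ) + 1 / (M * |ω|) := by
    rw [← sq_abs ω]; field_simp
  have hinv : 1 / (M * |ω|) ≤ 16 := by
    rw [div_le_iff₀ (by positivity)]
    rw [div_le_iff₀ (by positivity)] at hωlow
    linarith
  calc 6 + 6 * |ω| * max (7 * M) (max (Real.sqrt (12 * Λ) / |ω|) (1 / (M * ω ^ 2)))
      ≤ 6 + 6 * |ω| * (7 * M + Real.sqrt (12 * Λ) / |ω| + 1 / (M * ω ^ 2)) := by gcongr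
    _ = 6 + 6 * (7 * (M * |ω|) + Real.sqrt (12 * Λ) + 1 / (M * |ω|)) := by rw [mul_assoc, e]
    _ ≤ 6 + 6 * (7 * Real.sqrt Λ + 7 / 2 * Real.sqrt Λ + 16) := by gcongr
    _ ≤ 165 * Λ := by linarith

/-- **Final bookkeeping**: `X ≤ K₂·D·(CΛ^Nκ^{-N}W)` with `0 ≤ K₂ ≤ 165Λ`, `0 ≤ C, D, W`, `1 ≤ Λ`,
`0 < κ ≤ 1/(4M)` gives `X ≤ (42C/M)·Λ^{N+1}·κ^{-(N+1)}·D·W`. [folklore] -/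
theorem final_bookkeeping {X K₂ D C Λ κ W M : ℝ} {N : ℕ} (hM : 0 < M) (hκ : 0 < κ) (hκle : κ ≤ 1 / (4 * M))
    (hΛ1 : 1 ≤ Λ) (hC : 0 ≤ C) (hD : 0 ≤ D) (hW : 0 ≤ W) (hK₂ : K₂ ≤ 165 * Λ)
    (hX : X ≤ K₂ * D * (C * Λ ^ N * κ⁻¹ ^ N * W)) :
    X ≤ 42 * C / M * Λ ^ (N + 1) * κ⁻¹ ^ (N + 1) * D * W := by
  have h0 : 0 ≤ C * Λ ^ N * κ⁻¹ ^ N * W := by positivity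
  -- raise the exponent of `κ⁻¹` by one (`κ⁻¹ ≥ 4M`); the extra `Λ` comes from `K₂ ≤ 165Λ`
  have hraise' : C * Λ ^ N * κ⁻¹ ^ N * W ≤ C / (4 * M) ^ 1 * Λ ^ N * κ⁻¹ ^ (N + 1) * W := by
    have h4M : 0 < 4 * M := by positivity
    have hone : κ⁻¹ ^ N ≤ κ⁻¹ ^ (N + 1) / (4 * M) ^ 1 := by
      rw [pow_one, le_div_iff₀ h4M, pow_succ]
      refine mul_le_mul_of_nonneg_left ?_ (by positivity)
      calc 4 * M = (1 / (4 * M))⁻¹ := by rw [one_div, inv_inv]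
        _ ≤ κ⁻¹ := by rw [inv_le_inv₀ (by positivity) hκ]; exact hκle
    calc C * Λ ^ N * κ⁻¹ ^ N * W ≤ C * Λ ^ N * (κ⁻¹ ^ (N + 1) / (4 * M) ^ 1) * W := by gcongr
      _ = C / (4 * M) ^ 1 * Λ ^ N * κ⁻¹ ^ (N + 1) * W := by ring
  calc X ≤ K₂ * D * (C * Λ ^ N * κ⁻¹ ^ N * W) := hX
    _ ≤ 165 * Λ * D * (C * Λ ^ N * κ⁻¹ ^ N * W) :=
        mul_le_mul_of_nonneg_right (mul_le_mul_of_nonneg_right hK₂ hD) h0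
    _ ≤ 165 * Λ * D * (C / (4 * M) ^ 1 * Λ ^ N * κ⁻¹ ^ (N + 1) * W) :=
        mul_le_mul_of_nonneg_left hraise' (by positivity)
    _ = 165 / 4 * (C / M * Λ ^ (N + 1) * κ⁻¹ ^ (N + 1) * D * W) := by
        rw [pow_one, pow_succ]; field_simp; ring
    _ ≤ 42 * (C / M * Λ ^ (N + 1) * κ⁻¹ ^ (N + 1) * D * W) :=
        mul_le_mul_of_nonneg_right (by norm_num) (by positivity)
    _ = 42 * C / M * Λ ^ (N + 1) * κ⁻¹ ^ (N + 1) * D * W := by ring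

/-- **S6e · the extra two-point DECAY of the cone Green kernel across the angular barrier at large
`r`, Λ-polynomial constants** (registered statement of the skeleton v9.5, re-declared verbatim). -/
abbrev ConeBarrierDecayPoly : Prop :=
  ∀ M : ℝ, 0 < M → ∀ θ : ℝ, 0 < θ → ∀ Rb : ℝ, 7 * M ≤ Rb →
    ∃ (a₁ ε₀ Cc C c : ℝ) (N : ℕ), a₁ < M ∧ 0 < ε₀ ∧ 0 < Cc ∧ 0 < C ∧ 0 < c ∧
    ∀ a : ℝ, a₁ ≤ |a| → Kerr.IsSubextremal M a →
    ∀ Rf : ℝ, 2 * Rb ≤ Rf →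
    ∀ (ω : ℝ) (m : ℤ) (Λ : ℝ), Kerr.IsAdmissibleTriple a ω m Λ → m ≠ 0 →
      |ω - m * Kerr.horizonAngularVelocity M a| ≤ ε₀ * |(m : ℝ)| →
      Cc * (1 + ω ^ 2 * Rf ^ 2) ≤ Λ →
      ∀ RH RI : ℝ → ℂ,
        Kerr.IsRadialTeukolskySolution M a 0 ω m (Λ - a ^ 2 * ω ^ 2) RH →
        Kerr.IsNormalisedHorizonSolution M a 0 ω m RH →
        Kerr.IsRadialTeukolskySolution M a 0 ω m (Λ - a ^ 2 * ω ^ 2) RI →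
        Kerr.IsNormalisedInfinitySolution M 0 ω RI →
        ∀ r r' : ℝ, Kerr.rPlus M a + θ * (Kerr.rPlus M a - Kerr.rMinus M a) ≤ r → r ≤ Rb → Rf ≤ r' →
          Real.sqrt (r ^ 2 + a ^ 2) * ‖RH r‖ * (Real.sqrt (r' ^ 2 + a ^ 2) * ‖RI r'‖) ≤
            C * Λ ^ N * (Kerr.surfaceGravity M a)⁻¹ ^ N *
              (Rb / min r' (Real.sqrt (Λ / (Cc * (1 + ω ^ 2))))) ^ (c * Real.sqrt Λ) *
              ‖Kerr.radialWronskian M a 0 RH RI r‖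

set_option maxHeartbeats 400000 in
-- long assembly with many binders: kernel bound at `(r, R_b)` times the inward growth of `R_𝓘`
/-- **S6e · `stub_coneBarrierDecayPoly`** — the decay of the cone Green kernel across the angular
barrier with Λ-polynomial constants (registered signature, skeleton v9.5): the landed large-Λ
BF-stable cone kernel bound at the pair `(r, R_b)` times the inward growth of the `𝓘⁺`-mode through
the angular barrier (`Kerr.angularBarrier_decay_radial`). -/
theorem stub_coneBarrierDecayPoly : ConeBarrierDecayPoly := by
  intro M hM θ hθ Rb hRb
  obtain ⟨Λ₀, a₁, ε₀, C, N, ha₁, hε₀, hC, hker⟩ := coneKernel_largeStable_all M hM θ hθ 1 one_pos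
  set Cc : ℝ := max (Λ₀ + 1) 256 with hCc
  have hCc256 : (256 : ℝ) ≤ Cc := le_max_right _ _
  have hCc0 : 0 < Cc := lt_of_lt_of_le (by norm_num) hCc256
  refine ⟨max a₁ (M / 2), min ε₀ (1 / (16 * M)), Cc, 42 * C / M, 1 / 8, N + 1,
    max_lt ha₁ (by linarith), lt_min hε₀ (by positivity), hCc0, by positivity, by norm_num, ?_⟩
  intro a ha hsub Rf hRf ω m Λ hadm hm hcone hΛ RH RI hH hnH hI hnI r r' hr hrRb hr'
  have haM : |a| ≤ M := le_of_lt hsub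
  have ha2 : M / 2 ≤ |a| := le_trans (le_max_right _ _) ha
  have ha1 : a₁ ≤ |a| := le_trans (le_max_left _ _) ha
  have hconeε : |ω - m * Kerr.horizonAngularVelocity M a| ≤ ε₀ * |(m : ℝ)| :=
    hcone.trans (mul_le_mul_of_nonneg_right (min_le_left _ _) (abs_nonneg _))
  obtain ⟨hωlow, hmω, hMω⟩ := cone_omega_facts hM haM ha2 hm (min_le_right ε₀ _) hcone
  have hω0 : 0 < |ω| := lt_of_lt_of_le (by positivity) hωlow
  have hω : ω ≠ 0 := abs_pos.1 hω0
  -- `Λ ≥ Cc ≥ 256`, `Λ > Λ₀`, `Λ ≥ 256 ω² R_f²`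
  have hΛCc : Cc ≤ Λ := by nlinarith [sq_nonneg (ω * Rf)]
  have hΛ256 : (256 : ℝ) ≤ Λ := hCc256.trans hΛCc
  have hΛ1 : (1 : ℝ) ≤ Λ := by linarith
  have hΛ₀ : Λ₀ < Λ := by have := le_max_left (Λ₀ + 1) 256; linarith
  have hΛω : 256 * (ω ^ 2 * Rf ^ 2) ≤ Λ := by
    have : Cc * (ω ^ 2 * Rf ^ 2) ≤ Λ := by nlinarith
    nlinarith [sq_nonneg (ω * Rf)]
  -- the BF-stability margin `θ₁ = 1`
  have hst : (1 + 1) * (2 * Kerr.rPlus M a * ω) ^ 2 ≤ Λ - 2 * a * m * ω := by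
    have hrp : Kerr.rPlus M a ≤ 2 * M := Kerr.rPlus_le_two_mul_self hM.le a
    have hrp0 : 0 < Kerr.rPlus M a := Kerr.rPlus_pos hM a
    have h1 : (2 * Kerr.rPlus M a * ω) ^ 2 ≤ 16 * M ^ 2 * ω ^ 2 := by
      have h := pow_le_pow_left₀ hrp0.le hrp 2
      calc (2 * Kerr.rPlus M a * ω) ^ 2 = 4 * Kerr.rPlus M a ^ 2 * ω ^ 2 := by ring
        _ ≤ 4 * (2 * M) ^ 2 * ω ^ 2 := by gcongr
        _ = 16 * M ^ 2 * ω ^ 2 := by ring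
    have h2 : 2 * a * m * ω ≤ 32 * M ^ 2 * ω ^ 2 := by
      calc 2 * a * m * ω ≤ |2 * a * m * ω| := le_abs_self _
        _ = 2 * |a| * |(m : ℝ)| * |ω| := by
            rw [abs_mul, abs_mul, abs_mul, abs_of_pos (by norm_num : (0:ℝ) < 2)]
        _ ≤ 2 * M * (16 * M * |ω|) * |ω| := by gcongr
        _ = 32 * M ^ 2 * ω ^ 2 := by rw [← sq_abs ω]; ring
    have h3 : 64 * M ^ 2 * ω ^ 2 ≤ Λ := by
      have hRf : 14 * M ≤ Rf := by linarith
      have : (14 * M) ^ 2 * ω ^ 2 ≤ Rf ^ 2 * ω ^ 2 :=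
        mul_le_mul_of_nonneg_right (pow_le_pow_left₀ (by positivity) hRf 2) (sq_nonneg ω)
      nlinarith
    nlinarith
  have hκ : 0 < Kerr.surfaceGravity M a := (Kerr.surfaceGravity_pos_iff hM a).2 hsub
  have hκle : Kerr.surfaceGravity M a ≤ 1 / (4 * M) := Kerr.surfaceGravity_le hM a
  have hgap : 0 < θ * (Kerr.rPlus M a - Kerr.rMinus M a) := mul_pos hθ (sub_pos.2 hsub.rMinus_lt_rPlus)
  have hrp : Kerr.rPlus M a < r := by linarith
  have hRbr' : Rb ≤ r' := by linarith
  have hRb0 : 0 < Rb := by linarith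
  -- the radius `R_Λ`
  set RΛ := Real.sqrt (Λ / (Cc * (1 + ω ^ 2))) with hRΛ
  have hRΛ0 : 0 < RΛ := Real.sqrt_pos.2 (by positivity)
  have hRΛsq : RΛ ^ 2 = Λ / (Cc * (1 + ω ^ 2)) := Real.sq_sqrt (by positivity)
  have hΛRΛ : 256 * (ω ^ 2 * RΛ ^ 2) ≤ Λ := by
    rw [hRΛsq, ← mul_div_assoc, ← mul_div_assoc, div_le_iff₀ (by positivity)]
    have : 256 * ω ^ 2 ≤ Cc * (1 + ω ^ 2) := by nlinarith [sq_nonneg ω]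
    nlinarith
  have hmin0 : 0 < min r' RΛ := lt_min (by linarith) hRΛ0
  -- the decay factor
  set Dec := (Rb / min r' RΛ) ^ (1 / 8 * Real.sqrt Λ) with hDec
  have hDec0 : 0 ≤ Dec := Real.rpow_nonneg (by positivity) _
  have hWn : 0 ≤ ‖Kerr.radialWronskian M a 0 RH RI r‖ := norm_nonneg _
  show Real.sqrt (r ^ 2 + a ^ 2) * ‖RH r‖ * (Real.sqrt (r' ^ 2 + a ^ 2) * ‖RI r'‖) ≤
    42 * C / M * Λ ^ (N + 1) * (Kerr.surfaceGravity M a)⁻¹ ^ (N + 1) * Dec * ‖Kerr.radialWronskian M a 0 RH RI r‖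
  rcases lt_or_ge RΛ Rb with hsmall | hRbΛ
  · -- `R_Λ < R_b`: the decay factor is `≥ 1`, the plain kernel bound at `(r, r′)` suffices
    have hone : 1 ≤ Dec := by
      refine Real.one_le_rpow ?_ (by positivity)
      rw [le_div_iff₀ hmin0, one_mul]
      exact (min_le_right _ _).trans hsmall.le
    have h := hker a ha1 hsub ω m Λ hadm hm hΛ₀ hst hconeε RH RI hH hnH hI hnI r r' hrp (by linarith)
      (by linarith)
    refine final_bookkeeping (K₂ := 1) hM hκ hκle hΛ1 hC.le hDec0 hWn (by linarith) ?_
    calc _ ≤ C * Λ ^ N * (Kerr.surfaceGravity M a)⁻¹ ^ N * ‖Kerr.radialWronskian M a 0 RH RI r‖ := h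
      _ = 1 * 1 * (C * Λ ^ N * (Kerr.surfaceGravity M a)⁻¹ ^ N * ‖Kerr.radialWronskian M a 0 RH RI r‖) := by
          ring
      _ ≤ 1 * Dec * (C * Λ ^ N * (Kerr.surfaceGravity M a)⁻¹ ^ N * ‖Kerr.radialWronskian M a 0 RH RI r‖) := by
          gcongr
  · -- `R_b ≤ R_Λ`: kernel bound at `(r, R_b)` times the inward growth of `R_𝓘` from `R_b` to `r′`
    have hK := hker a ha1 hsub ω m Λ hadm hm hΛ₀ hst hconeε RH RI hH hnH hI hnI r Rb hrp hrRb
      (by linarith)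
    have hdecay := Kerr.angularBarrier_decay_radial hsub hadm hω hΛRΛ (by linarith) hRb hRbΛ hI hnI hRbr'
    set K₂ := 6 + 6 * |ω| * max (7 * M) (max (Real.sqrt (12 * Λ) / |ω|) (1 / (M * ω ^ 2))) with hK₂def
    have hK₂ : K₂ ≤ 165 * Λ := by
      refine decayConst_le hM hωlow (hMω.trans ?_) hΛ1
      exact Real.abs_le_sqrt hadm.sq_le
    -- `B′ ≤ K₂ · Dec · B`
    set B' := Real.sqrt (r' ^ 2 + a ^ 2) * ‖RI r'‖ with hB'
    set B := Real.sqrt (Rb ^ 2 + a ^ 2) * ‖RI Rb‖ with hB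
    set A := Real.sqrt (r ^ 2 + a ^ 2) * ‖RH r‖ with hA
    have hA0 : 0 ≤ A := by positivity
    have hB0 : 0 ≤ B := by positivity
    have hx : 0 < min r' RΛ / Rb := by positivity
    have hP : 0 < (min r' RΛ / Rb) ^ (Real.sqrt Λ / 8) := Real.rpow_pos_of_pos hx _
    have hDecinv : Dec = ((min r' RΛ / Rb) ^ (Real.sqrt Λ / 8))⁻¹ := by
      rw [hDec, ← Real.inv_rpow hx.le, inv_div, show 1 / 8 * Real.sqrt Λ = Real.sqrt Λ / 8 by ring]
    have hB'le : B' ≤ K₂ * Dec * B := by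
      rw [hDecinv, mul_assoc, mul_comm _ B, ← mul_assoc, ← div_eq_mul_inv, le_div_iff₀ hP]
      exact hdecay
    have hK₂0 : 0 ≤ K₂ * Dec := by
      have : 0 ≤ K₂ := by rw [hK₂def]; positivity
      positivity
    refine final_bookkeeping hM hκ hκle hΛ1 hC.le hDec0 hWn hK₂ ?_
    calc A * B' ≤ A * (K₂ * Dec * B) := mul_le_mul_of_nonneg_left hB'le hA0
      _ = K₂ * Dec * (A * B) := by ring
      _ ≤ K₂ * Dec * (C * Λ ^ N * (Kerr.surfaceGravity M a)⁻¹ ^ N * ‖Kerr.radialWronskian M a 0 RH RI r‖) :=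
          mul_le_mul_of_nonneg_left hK hK₂0

end Summit.FinalStateConjecture.FinalStateConjecture.Theorems.KappaExplicitWaveDecay.OlverDunsterUniformReduction

end
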